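import Mathlib
import Summits.KontsevichZagierPeriods.Zeta5Search.RayFaceKitCover
import Summits.KontsevichZagierPeriods.Zeta5Search.Ray5Points
import HarnessLib

/-!
# ζ(5) search — RAY FACE KIT V: the T1-map ray #5 (C5) `b(n) = n·(51; 21,19,18,16,15,13,12)` (P1 g14)

HONEST FRAMING: systematic search; no irrationality claim unless certified.  Cell `pub-zeta5`, prover seat P1, generation 14.
Integer bookkeeping of net exponents; every kernel exponent the consumers feed stays `< 1` — no irrationality content; nothing
about `ζ(5)`.

Instantiation of the face kit (`RayFaceKit`, `RayFaceKitCover`) for `T1Rays.bRay β5 n` (census class g8 #5): the block form of its net exponents is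
gen-2's `Ray5Points.netExp_eq` + `blockCount_eq` (blocks `[21n,30n]`, `[19n,32n]`, `[18n,33n]`, `[16n,35n]`, `[15n,36n]`,
`[13n,38n]`, `[12n,39n]`, `b₀ = 51n`), so `c5_cover` turns ONE `decide +kernel` of `faceCheck 51 7 los5 his5 c` into the class-type
cover `Cover (bRay β5 n) p (coverOf 7 c)` on the whole window of the certificate (same shape as `RayC1FaceKit.c1_cover`, P1 g14);
the generator is `code/p1/g14/kit/facekit_c1.py` with `B0, LOS, HIS = 51, [21,19,18,16,15,13,12], [30,32,33,35,36,38,39]`.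
-/

namespace Summit.KontsevichZagierPeriods.Zeta5Search.RayC5FaceKit

open Summit.KontsevichZagierPeriods.Zeta5Search.RayFaceKit
open Summit.KontsevichZagierPeriods.Zeta5Search.ClassTypeCover (Cover)
open Summit.KontsevichZagierPeriods.Zeta5Search.ClusterValuation (netExp)
open Summit.KontsevichZagierPeriods.Zeta5Search.T1Rays (bRay β5 ray5_zero)
open Summit.KontsevichZagierPeriods.Zeta5Search.T1Rays.Ray5Points (netExp_eq blockCount_eq)

/-- Lower block coefficients of ray C5 (block `j` is `[los5[j]·n, his5[j]·n]`). -/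
def los5 : List ℕ := [21, 19, 18, 16, 15, 13, 12]

/-- Upper block coefficients of ray C5. -/
def his5 : List ℕ := [30, 32, 33, 35, 36, 38, 39]

/-- The block form of the net exponents of ray C5 (`Ray5Points.netExp_eq` + `blockCount_eq`). -/
theorem c5_netExp (n q : ℕ) :
    netExp (bRay β5 n) q = 1 - (blockSum 7 los5 his5 n q : ℤ) + if 2 * q = 51 * n then 1 else 0 := by
  rw [netExp_eq, blockCount_eq]; rfl

/-- **Ray-C5 cover from a checked face certificate.** -/
theorem c5_cover (c : FaceCert) (hc : faceCheck 51 7 los5 his5 c = true) {n p : ℕ} [Fact p.Prime]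
    (hn : c.win.N0 ≤ n) (hr : n % 2 = c.win.r) (hp2 : p % 2 = 1) (hA : c.win.a1 * n < c.win.a2 * p)
    (hB : c.win.b2 * p < c.win.b1 * n) : Cover (bRay β5 n) p (coverOf 7 c) :=
  cover_of_faceCheck (B0 := 51) (fun n => ray5_zero n) (fun n q => c5_netExp n q) hc ⟨hn, hA, hB, hr, hp2⟩

end Summit.KontsevichZagierPeriods.Zeta5Search.RayC5FaceKit
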